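import Summits.AtomisticToContinuum.BoseEinsteinCondensation.Theorems.BECGroundStateSOSPeriodicIRBoundDefs
import Literature.MathematicalPhysics.QuantumManyBody.PeriodicBoseGasScattering
import Literature.MathematicalPhysics.QuantumManyBody.BoseGasThermodynamicLimitRuelle
import Literature.MathematicalPhysics.QuantumManyBody.BoseGasDirichletWall
import HarnessLib

/-!
# Route `BECGroundStateSOS`, crux `PeriodicIRBound` (stmt-AtomisticToContinuum-3972),
# line `linear-ph-floor-wagner` — stub 4 `stub_linearFloor_of_landau : LinearFloorOfLandau`

The currency conversion `EnergyConvexityWindow → LandauSectorBound → LinearParticleHoleFloor`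
(stmt-9094 → stmt-9091 → `C⁺`), the linear twin of the filed support item
`BECSectorPoincareTwoScale.LandauFloorToSectorGap` (stmt-9096); statements in the line's `Defs`
module `Theorems/BECGroundStateSOSPeriodicIRBoundDefs.lean`.

Proof. Fix admissible `v` with `∫ v(|x|)dx ≠ 0` and a window constant `C > 0`.
* `a := scatteringLength v` is finite (finite range, `scatteringLength_ne_top_of_finiteRange`) and
  nonzero (`a = 0` forces `v(|·|) = 0` a.e., `LSSY2005_zeroScatteringLength_holds`, contradicting
  `∫v ≠ 0`), so `0 < a.toReal`.
* Apply stmt-9091 with `M₀ := √(C/a)` (output `θ, ρ₀ᴸ`) and stmt-9094 with `ε := πθ` (output `ρ₁`);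
  the constants of `C⁺` are `θ' := (3/4)θ√a`, `ρ₀ := min ρ₀ᴸ ρ₁`.
* For `0 < ρ < ρ₀` pull the Landau eventual set back along `N ↦ N ± 1` and intersect with the
  convexity set at `N` and `N ≥ 2`; in the box `L = L_N`, `L³ = N/ρ`, the densities `ρ`,
  `ρ(N ± 1)/N` lie in `[ρ/2, 2ρ]`.
* Off the dual lattice `(2π/L)ℤ³` both sector energies are `⊤`
  (`momentumSectorEnergy_eq_top_of_forall_ne`). For `k = 2πm/L`, `m ≠ 0`:
  `2π/L ≤ ‖k‖ ≤ √(Cρ) = M₀√(ρa)`, the Bloch condition of `HasTotalMomentum k` is the one of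
  stmt-9091, so `E₀(N±1,L) + θ√(ρa)‖k‖ ≤ E_{N±1}(k;L)`; with `2E₀(N,L) ≤ E₀(N+1,L) + E₀(N-1,L) +
  πθ√(ρa)/L` and `πθ√(ρa)/L + 2θ'√ρ‖k‖ ≤ 2θ√(ρa)‖k‖` (from `2π/L ≤ ‖k‖`) the floor follows by
  monotone `ℝ≥0∞` bookkeeping (no subtraction).
-/

noncomputable section

open scoped BigOperators ENNReal
open Filter MeasureTheory

namespace Summit.AtomisticToContinuum.BoseEinsteinCondensation.Cruxes.PeriodicIRBound.LinearPhFloorWagner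

open Literature.MathematicalPhysics.QuantumManyBody.BoseGas
open Summit.AtomisticToContinuum.BoseEinsteinCondensation.Theses.BECSectorPoincareTwoScale
  (LandauSectorBound EnergyConvexityWindow)

/-! ### Helper lemmas -/

/-- The dual-lattice vector `latticeVec c m` is `c • m` with `m` viewed in `ℝ³`. [folklore] -/
private theorem latticeVec_eq_smul (c : ℝ) (m : Fin 3 → ℤ) :
    latticeVec c m = c • (WithLp.toLp 2 fun t => (m t : ℝ) : EuclideanSpace ℝ (Fin 3)) := by
  ext i
  simp [latticeVec, PiLp.toLp_apply]

/-- `‖latticeVec c m‖ = c‖m‖` for `c ≥ 0`. [folklore] -/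
private theorem norm_latticeVec_of_nonneg {c : ℝ} (hc : 0 ≤ c) (m : Fin 3 → ℤ) :
    ‖latticeVec c m‖ = c * ‖(WithLp.toLp 2 fun t => (m t : ℝ) : EuclideanSpace ℝ (Fin 3))‖ := by
  rw [latticeVec_eq_smul, norm_smul, Real.norm_of_nonneg hc]

/-- A nonzero integer vector has Euclidean norm at least `1`. [folklore] -/
private theorem one_le_norm_toLp_intCast {m : Fin 3 → ℤ} (hm : m ≠ 0) :
    1 ≤ ‖(WithLp.toLp 2 fun t => (m t : ℝ) : EuclideanSpace ℝ (Fin 3))‖ := by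
  obtain ⟨t, ht⟩ : ∃ t, m t ≠ 0 := by
    by_contra h
    push Not at h
    exact hm (funext h)
  have h1 : (1 : ℝ) ≤ |(m t : ℝ)| := by exact_mod_cast Int.one_le_abs ht
  calc (1 : ℝ) ≤ |(m t : ℝ)| := h1
    _ = ‖(WithLp.toLp 2 fun t => (m t : ℝ) : EuclideanSpace ℝ (Fin 3)) t‖ := by
        rw [PiLp.toLp_apply, Real.norm_eq_abs]
    _ ≤ _ := PiLp.norm_apply_le _ t

/-- The Bloch sum of a dual-lattice momentum: `∑ⱼ (2πm/L)ⱼ sⱼ = (2π/L) ∑ⱼ mⱼ sⱼ`. [folklore] -/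
private theorem sum_latticeVec_mul (L : ℝ) (m : Fin 3 → ℤ) (s : EuclideanSpace ℝ (Fin 3)) :
    (∑ j, (latticeVec (2 * Real.pi / L) m) j * s j) =
      2 * Real.pi / L * ∑ t, (m t : ℝ) * s t := by
  rw [Finset.mul_sum]
  exact Finset.sum_congr rfl fun t _ => by simp only [latticeVec, PiLp.toLp_apply]; ring

/-- A state of total momentum `2πm/L` (`HasTotalMomentum`) satisfies the Bloch condition in the
form quantified in `LandauSectorBound`. [folklore] -/
private theorem bloch_of_hasTotalMomentum {M : ℕ} {L : ℝ} {m : Fin 3 → ℤ} {ψ : Config M → ℂ}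
    (hψ : HasTotalMomentum (latticeVec (2 * Real.pi / L) m) ψ) :
    ∀ (X : Config M) (s : EuclideanSpace ℝ (Fin 3)),
      ψ (fun j => X j + s) =
        Complex.exp (Complex.I * ↑(2 * Real.pi / L * ∑ t : Fin 3, (m t : ℝ) * s t)) * ψ X := by
  intro X s
  rw [hψ s X, sum_latticeVec_mul]

/-- Density windows at particle numbers `N`, `N + 1`, `N - 1` in the box `L³ = N/ρ`, `N ≥ 2`.
[folklore] -/
private theorem density_windows {ρ L : ℝ} {N : ℕ} (hρ : 0 < ρ) (hN : 2 ≤ N)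
    (hL3 : L ^ 3 = N / ρ) :
    (ρ / 2 ≤ (N : ℝ) / L ^ 3 ∧ (N : ℝ) / L ^ 3 ≤ 2 * ρ) ∧
    (ρ / 2 ≤ ((N + 1 : ℕ) : ℝ) / L ^ 3 ∧ ((N + 1 : ℕ) : ℝ) / L ^ 3 ≤ 2 * ρ) ∧
    (ρ / 2 ≤ ((N - 1 : ℕ) : ℝ) / L ^ 3 ∧ ((N - 1 : ℕ) : ℝ) / L ^ 3 ≤ 2 * ρ) := by
  have hNr : (2 : ℝ) ≤ N := by exact_mod_cast hN
  have hN0 : (0 : ℝ) < N := by linarith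
  have h1N : 1 ≤ N := by omega
  have hw : ∀ M : ℕ, (M : ℝ) / L ^ 3 = ρ * M / N := fun M => by
    rw [hL3, div_div_eq_mul_div, mul_comm]
  simp only [hw]
  push_cast [Nat.cast_sub h1N]
  refine ⟨⟨?_, ?_⟩, ⟨?_, ?_⟩, ⟨?_, ?_⟩⟩
  · rw [le_div_iff₀ hN0]; nlinarith
  · rw [div_le_iff₀ hN0]; nlinarith
  · rw [le_div_iff₀ hN0]; nlinarith
  · rw [div_le_iff₀ hN0]; nlinarith
  · rw [le_div_iff₀ hN0]; nlinarith
  · rw [div_le_iff₀ hN0]; nlinarith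

/-- The real-arithmetic absorption of the convexity allowance `ε√(ρa)/L`, `ε = πθ`, by the Landau
floor, using `2π/L ≤ |k|`, with output constant `θ' = (3/4)θ√a`. [folklore] -/
private theorem real_absorb {θ ρ ar L nk : ℝ} (hθ : 0 ≤ θ) (hρ : 0 ≤ ρ) (hL : 0 < L)
    (hk : 2 * Real.pi / L ≤ nk) :
    Real.pi * θ * Real.sqrt (ρ * ar) / L + 2 * (3 / 4 * θ * Real.sqrt ar) * Real.sqrt ρ * nk ≤
      θ * Real.sqrt (ρ * ar) * nk + θ * Real.sqrt (ρ * ar) * nk := by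
  have hS : Real.sqrt (ρ * ar) = Real.sqrt ρ * Real.sqrt ar := Real.sqrt_mul hρ ar
  have h1 : Real.pi / L ≤ nk / 2 := by
    rw [div_le_iff₀ hL] at hk ⊢
    linarith
  calc Real.pi * θ * Real.sqrt (ρ * ar) / L + 2 * (3 / 4 * θ * Real.sqrt ar) * Real.sqrt ρ * nk
      = θ * Real.sqrt (ρ * ar) * (Real.pi / L) + 3 / 2 * (θ * Real.sqrt (ρ * ar) * nk) := by
        rw [hS]; ring
    _ ≤ θ * Real.sqrt (ρ * ar) * (nk / 2) + 3 / 2 * (θ * Real.sqrt (ρ * ar) * nk) := by gcongr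
    _ = θ * Real.sqrt (ρ * ar) * nk + θ * Real.sqrt (ρ * ar) * nk := by ring

/-- `ℝ≥0∞` bookkeeping of the assembly: convexity at `N`, the absorbed real inequality and the
two sector floors at `N ± 1` give the particle–hole floor, without subtraction. [folklore] -/
private theorem assemble {E EP EM SP SM : ℝ≥0∞} {x y z : ℝ}
    (hconv : 2 * E ≤ EP + EM + ENNReal.ofReal x) (hreal : x + y ≤ z + z)
    (hP : EP + ENNReal.ofReal z ≤ SP) (hM : EM + ENNReal.ofReal z ≤ SM)
    (hx : 0 ≤ x) (hy : 0 ≤ y) (hz : 0 ≤ z) :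
    2 * E + ENNReal.ofReal y ≤ SP + SM := by
  calc 2 * E + ENNReal.ofReal y ≤ EP + EM + ENNReal.ofReal x + ENNReal.ofReal y :=
        add_le_add hconv le_rfl
    _ = EP + EM + ENNReal.ofReal (x + y) := by rw [ENNReal.ofReal_add hx hy, add_assoc]
    _ ≤ EP + EM + ENNReal.ofReal (z + z) := add_le_add le_rfl (ENNReal.ofReal_le_ofReal hreal)
    _ = (EP + ENNReal.ofReal z) + (EM + ENNReal.ofReal z) := by
        rw [ENNReal.ofReal_add hz hz]
        exact add_add_add_comm _ _ _ _
    _ ≤ SP + SM := add_le_add hP hM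

/-! ### The stub -/

/-- **Stub 4 — `EnergyConvexityWindow → LandauSectorBound → C⁺`.** For admissible `v` with
`∫v ≠ 0` the scattering length `a` is finite (finite range) and nonzero (`a = 0` forces `v = 0`
a.e., LSSY2005 App. C), so `M₀ := √(C/a)` is admissible in stmt-9091; its floor at particle numbers
`N ± 1` in the box `L_N³ = N/ρ` (densities `ρ(N±1)/N ∈ [ρ/2, 2ρ]` for `N ≥ 2`), the emptiness of
the Bloch classes off the dual lattice, and stmt-9094 at `N` with `ε := πθ` (absorbed through
`|k| ≥ 2π/L_N`) give `C⁺` with `θ' = (3/4)θ√a`. [folklore] -/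
theorem stub_linearFloor_of_landau : LinearFloorOfLandau := by
  intro hconv hlandau v hv hv0 C hC
  -- Step 1: the scattering length is finite and nonzero
  obtain ⟨R₀, hR₀⟩ := hv.2
  have ha_top : scatteringLength v ≠ ⊤ := scatteringLength_ne_top_of_finiteRange hR₀
  have ha_ne : scatteringLength v ≠ 0 := by
    intro ha0
    apply hv0
    have hae : ∀ᵐ x : Space, v ‖x‖ = 0 :=
      LSSY2005_zeroScatteringLength_holds v R₀ hv.1 hR₀ ha0
    exact lintegral_eq_zero_of_ae_eq_zero hae
  have har : 0 < (scatteringLength v).toReal := ENNReal.toReal_pos ha_ne ha_top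
  -- Step 2: the constants
  obtain ⟨θ, hθ, ρL, hρL, HL⟩ :=
    hlandau v hv (Real.sqrt (C / (scatteringLength v).toReal)) (Real.sqrt_pos.2 (div_pos hC har))
  obtain ⟨ρ₁, hρ₁, HC⟩ := hconv v hv
  refine ⟨3 / 4 * θ * Real.sqrt (scatteringLength v).toReal, by positivity, min ρL ρ₁,
    lt_min hρL hρ₁, fun ρ hρ hρ₀ => ?_⟩
  have hρL' : ρ < ρL := lt_of_lt_of_le hρ₀ (min_le_left _ _)
  have hρ₁' : ρ < ρ₁ := lt_of_lt_of_le hρ₀ (min_le_right _ _)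
  -- Step 3: the eventual sets, at particle numbers `N + 1`, `N - 1` (Landau) and `N` (convexity)
  filter_upwards [(tendsto_add_atTop_nat 1).eventually (HL ρ hρ hρL'),
    (tendsto_sub_atTop_nat 1).eventually (HL ρ hρ hρL'),
    HC (Real.pi * θ) (mul_pos Real.pi_pos hθ) ρ hρ hρ₁', eventually_ge_atTop 2]
    with N hNp hNm hNc hN2
  intro k hk hkC
  -- Step 4: the box
  have hN0 : 0 < N := by omega
  have hL : 0 < sideLength ρ N := sideLength_pos_of_pos hρ hN0
  have hL3 : sideLength ρ N ^ 3 = N / ρ := sideLength_pow_three hρ N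
  set L := sideLength ρ N
  obtain ⟨⟨hw1, hw2⟩, ⟨hwP1, hwP2⟩, ⟨hwM1, hwM2⟩⟩ := density_windows hρ hN2 hL3
  -- Step 5: off the dual lattice both sectors are empty
  by_cases hlat : ∃ m : Fin 3 → ℤ, k = latticeVec (2 * Real.pi / L) m
  swap
  · push Not at hlat
    have h1 : momentumSectorEnergy v (N + 1) L k = ⊤ :=
      momentumSectorEnergy_eq_top_of_forall_ne hL v hlat
    rw [h1, top_add]
    exact le_top
  obtain ⟨m, rfl⟩ := hlat
  have hm : m ≠ 0 := by
    rintro rfl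
    exact hk (latticeVec_zero _)
  -- norms
  have hc : 0 ≤ 2 * Real.pi / L := (div_pos Real.two_pi_pos hL).le
  have hnorm := norm_latticeVec_of_nonneg hc m
  have hklow : 2 * Real.pi / L ≤ ‖latticeVec (2 * Real.pi / L) m‖ := by
    rw [hnorm]
    exact le_mul_of_one_le_right hc (one_le_norm_toLp_intCast hm)
  have hkM : 2 * Real.pi / L * ‖(WithLp.toLp 2 fun t => (m t : ℝ) : EuclideanSpace ℝ (Fin 3))‖ ≤
      Real.sqrt (C / (scatteringLength v).toReal) *
        Real.sqrt (ρ * (scatteringLength v).toReal) := by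
    rw [← hnorm, ← Real.sqrt_mul (div_pos hC har).le,
      show C / (scatteringLength v).toReal * (ρ * (scatteringLength v).toReal) = C * ρ by
        field_simp,
      ← Real.sqrt_sq (norm_nonneg (latticeVec (2 * Real.pi / L) m))]
    exact Real.sqrt_le_sqrt hkC
  -- the Landau floors at `N + 1` and `N - 1`
  have hP : periodicGroundStateEnergy v (N + 1) L +
        ENNReal.ofReal (θ * Real.sqrt (ρ * (scatteringLength v).toReal) *
          (2 * Real.pi / L * ‖(WithLp.toLp 2 fun t => (m t : ℝ) : EuclideanSpace ℝ (Fin 3))‖)) ≤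
      momentumSectorEnergy v (N + 1) L (latticeVec (2 * Real.pi / L) m) :=
    le_momentumSectorEnergy_iff.2 fun Ψ hΨ =>
      hNp L hL hwP1 hwP2 m hm hkM Ψ (bloch_of_hasTotalMomentum hΨ)
  have hM : periodicGroundStateEnergy v (N - 1) L +
        ENNReal.ofReal (θ * Real.sqrt (ρ * (scatteringLength v).toReal) *
          (2 * Real.pi / L * ‖(WithLp.toLp 2 fun t => (m t : ℝ) : EuclideanSpace ℝ (Fin 3))‖)) ≤
      momentumSectorEnergy v (N - 1) L (latticeVec (2 * Real.pi / L) m) :=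
    le_momentumSectorEnergy_iff.2 fun Ψ hΨ =>
      hNm L hL hwM1 hwM2 m hm hkM Ψ (bloch_of_hasTotalMomentum hΨ)
  rw [← hnorm] at hP hM
  -- convexity at `N` and assembly
  exact assemble (hNc L hL hw1 hw2) (real_absorb hθ.le hρ.le hL hklow) hP hM (by positivity)
    (by positivity) (by positivity)

end Summit.AtomisticToContinuum.BoseEinsteinCondensation.Cruxes.PeriodicIRBound.LinearPhFloorWagner

end
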